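import Literature.IUT.HodgeArakelov.EtaleThetaDataOfSettingAutActionInner
import Literature.IUT.HodgeArakelov.EtaleThetaDataOfSettingKummerTower

/-!
# [IUTchII] Prop 3.4 (i), binder (P3) at the GENUINE constants `ℚ̄_pˣ ⊇ 𝒪^▷`: the semilinear companion of
# `α ∈ Aut_top(Π^tp_X̲̲)` IS a Galois element `τ_α ∈ G_{ℚ_p}` — `hsemi` split into its two printed functorialities

Proof-only companion (abc-iut cell, D-0067 wave 4, seat abc-iut-w4-d007 gen 7; layer L6; GAP-LEDGER row
**G-w5d169-3** in its reduced form «hsemi» (abc-iut-w5-d169 08:53Z): "∀ α ∃ e : ℚ̄_pˣ ≃* ℚ̄_pˣ semilinear over α for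
`unitsAction`, `c ∘ Λ(e) = rangeAut α ∘ c`, `e(𝒪^▷) = 𝒪^▷`", binder (P3) of node IUTchII:Prop3.4(i) at THIS lineage's
Kummer map `h1LimKummerOn … O` and cyclotome-tower coefficients `c`).  No definitions, no `Prop`-valued definition,
no named fact; nothing of abc-iut-w5-d169's files is restated (their `hsemi` is the OUTPUT shape here).

S. Mochizuki, *Inter-universal Teichmüller theory II*, kurims manuscript (Dec. 2020): Prop. 3.1 (ii) p. 88 ll. 2–9,
Prop. 3.4 (i) p. 91, Cor. 1.11 (a), (b) p. 49 ("functorial group-theoretic algorithm … `μ_Ẑ(G) ⥲ μ_Ẑ(O^×(G))`,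
`μ_Ẑ(G) ⥲ (l·Δ_Θ)(Π)`") [cite: Mochizuki2012, Cor 1.11 p.49]; *Topics in absolute anabelian geometry III*, Thm. 1.9 /
Cor. 1.10 p. 46 (functorial reconstruction of `k̄` with its `Π`-action from `Π`), Prop. 3.2 (i), (ii) p. 71.
Claim key `Mochizuki2012` (D-0012, DISPUTED) for the [IUTchII] interface; [AbsTopIII] refereed; nothing here takes a
side on [IUTchIII] Cor. 3.12.

WHAT IS PROVED.  At the model `Π = Π^tp_X̲̲ = Pi C` with the Galois action of `Π` on `A = ℚ̄_pˣ` through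
`ε = aug C : Π → G_{ℚ_p}` (`unitsAction`, this lineage p418848), for `α ∈ Aut_top(Π^tp_X̲̲)` and `τ ∈ G_{ℚ_p}` with
**(HGAL) `ε ∘ α = Inn(τ) ∘ ε`** ("`α` lies over the inner automorphism `Inn(τ)|_{G_K}`" — the MLF reading of
[AbsTopIII] Cor. 1.10: the field automorphism of `k̄ = ℚ̄_p` induced by `α` is `ᾱ`-semilinear, hence fixes `ℚ_p`, hence
IS an element of `G_{ℚ_p}`):
* `unitsGalEquiv_semilinear` — the automorphism `e_τ := (u ↦ τ u)` of `ℚ̄_pˣ` is SEMILINEAR over `α`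
  (`x • e_τ a = e_τ (α⁻¹ x • a)`), and `mem_iff_unitsGalEquiv_mem` — it carries every `G_{ℚ_p}`-stable submonoid
  `O` (`𝒪^▷`, `𝒪^×`) onto itself: the third conjunct of «hsemi» is AUTOMATIC;
* `coe_hom_map_unitsGalEquiv_eq_of_natural` — the second conjunct «`c ∘ Λ(e_τ) = rangeAut α ∘ c`» FOLLOWS from
  **(HCYC)** naturality of the model's level-`M` cyclotomic rigidity identifications `red_M : l·Δ_Θ ↠ μ_M` under
  `(α, τ)`: `red_M (ᾱ z) = τ (red_M z)` for all `M`, `z` (`ᾱ` = abc-iut-w5-d169's `rangeAutOfCor218i α` on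
  `l·Δ_Θ ⊆ φ(Π^tp_X̲̲)`) — by the joint injectivity of the tower under the origin guard
  (`eq_of_forall_modAll_red_eq`, this lineage p422741) and `red_M (c ζ) = ζ_M`;
* **`hsemi_units_of_galois`** — hence «hsemi» for `A = ℚ̄_pˣ`, ANY `G_{ℚ_p}`-stable `O`, and the tower coefficients
  `c`, from `∀ α ∃ τ, (HGAL) ∧ (HCYC)`: binder (P3) of [IUTchII] Prop. 3.4 (i) at the genuine constant-monoid Kummer
  map now rests on exactly two print-located functorialities — [AbsTopIII] Cor. 1.10 (Galois side) and [IUTchII]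
  Cor. 1.11 (b) / [EtTh] Cor. 2.19 (i) (cyclotomic-rigidity side);
* NON-VACUITY / CONSISTENCY: **`hgal_of_inner`** — for every INNER `α = conj g` both (HGAL) (with `τ = ε g`) and
  (HCYC) are THEOREMS (`red_conj` of the tower + abc-iut-w5-d169's `rangeAut_apply_of_inner`): the residual input
  concerns outer automorphisms of `Π^tp_X̲̲` only.
Typed ≠ discharged for (HGAL), (HCYC) at outer `α`; instantiated ≠ endorsed.
-/

noncomputable section

open Topology

namespace Literature.IUT.HodgeArakelov

namespace EtaleThetaDataOfSetting

open Literature.AnabelianGeometry.EtaleTheta Literature.AnabelianGeometry.SemiGraphs CohomologySystemOfContH1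
open Literature.AnabelianGeometry.SemiGraphs.Thm68Sub (conjCME conjCME_apply)

variable {p : ℕ} [Fact p.Prime] {D : Literature.AnabelianGeometry.EtaleTheta.ThetaSetting p}
  {E : D.EtaleThetaData} {l : ℕ} (C : E.DoubleUnderline l)

/-! ### 1. The Galois element `τ` as a semilinear automorphism of `ℚ̄_pˣ` -/

section Galois

variable (α : (Pi C) ≃ₜ* (Pi C)) (τ : GQp p) (hτ : ∀ x : Pi C, aug C (α x) = τ * aug C x * τ⁻¹)

/-- `e_τ := Units.mapEquiv τ` on elements: `(e_τ u : ℚ̄_p) = τ u`. [cite: MochizukiAbsTopIII2015, Prop 3.2 (i) p.71] -/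
theorem coe_unitsGalEquiv (u : (PadicAlgCl p)ˣ) :
    ((Units.mapEquiv (τ : PadicAlgCl p ≃ₐ[ℚ_[p]] PadicAlgCl p).toMulEquiv u : (PadicAlgCl p)ˣ) : PadicAlgCl p) =
      τ (u : PadicAlgCl p) := rfl

include hτ in
/-- (HGAL) read backwards: `ε x = τ · ε(α⁻¹ x) · τ⁻¹`. [cite: MochizukiAbsTopIII2015, Cor 1.10 p.46] -/
theorem aug_eq_conj_aug_symm (x : Pi C) : aug C x = τ * aug C (α.symm x) * τ⁻¹ := by
  rw [← hτ, ContinuousMulEquiv.apply_symm_apply]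

include hτ in
/-- **`e_τ` is SEMILINEAR over `α`**: `x • e_τ a = e_τ (α⁻¹ x • a)` for the Galois action of `Π^tp_X̲̲` on `ℚ̄_pˣ`
through `ε` — the first conjunct of «hsemi» (the isomorphism of MLF-pairs `(Π ↷ k̄ˣ)` induced by `α`,
[AbsTopIII] Prop. 3.2 (i)). [cite: MochizukiAbsTopIII2015, Prop 3.2 (i) p.71] -/
theorem unitsGalEquiv_semilinear (x : Pi C) (a : (PadicAlgCl p)ˣ) :
    x • Units.mapEquiv (τ : PadicAlgCl p ≃ₐ[ℚ_[p]] PadicAlgCl p).toMulEquiv a =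
      Units.mapEquiv (τ : PadicAlgCl p ≃ₐ[ℚ_[p]] PadicAlgCl p).toMulEquiv (α.symm x • a) := by
  apply Units.ext
  rw [units_coe_smul, coe_unitsGalEquiv, coe_unitsGalEquiv, units_coe_smul, aug_eq_conj_aug_symm C α τ hτ x,
    AlgEquiv.mul_apply, AlgEquiv.mul_apply, AlgEquiv.aut_inv, AlgEquiv.symm_apply_apply]

/-- **`e_τ` carries every `G_{ℚ_p}`-stable submonoid `O ≤ ℚ̄_pˣ` onto itself** (`𝒪^▷_{k̄}`, `𝒪^×_{k̄}`: Galois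
automorphisms preserve integrality) — the third conjunct of «hsemi» is automatic. [cite: Mochizuki2012, Prop 3.1 (ii) p.88] -/
theorem mem_iff_unitsGalEquiv_mem (O : Submonoid (PadicAlgCl p)ˣ)
    (hO : ∀ (σ : GQp p) (u : (PadicAlgCl p)ˣ), u ∈ O → Units.map (σ : PadicAlgCl p →* PadicAlgCl p) u ∈ O)
    (a : (PadicAlgCl p)ˣ) :
    a ∈ O ↔ Units.mapEquiv (τ : PadicAlgCl p ≃ₐ[ℚ_[p]] PadicAlgCl p).toMulEquiv a ∈ O := by
  have key : ∀ (σ : GQp p) (u : (PadicAlgCl p)ˣ),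
      Units.map (σ : PadicAlgCl p →* PadicAlgCl p) u =
        Units.mapEquiv (σ : PadicAlgCl p ≃ₐ[ℚ_[p]] PadicAlgCl p).toMulEquiv u :=
    fun σ u => Units.ext rfl
  constructor
  · intro ha
    rw [← key]
    exact hO τ a ha
  · intro ha
    have h := hO τ⁻¹ _ ha
    rw [key] at h
    have hback : Units.mapEquiv (τ⁻¹ : PadicAlgCl p ≃ₐ[ℚ_[p]] PadicAlgCl p).toMulEquiv
        (Units.mapEquiv (τ : PadicAlgCl p ≃ₐ[ℚ_[p]] PadicAlgCl p).toMulEquiv a) = a := by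
      apply Units.ext
      rw [coe_unitsGalEquiv, coe_unitsGalEquiv, AlgEquiv.aut_inv, AlgEquiv.symm_apply_apply]
    rwa [hback] at h

end Galois

/-! ### 2. The cyclotome compatibility from naturality of the level-`M` identifications -/

section Cyclotome

variable (hq : IsQuotientMap D.toTheta) {N : ℕ+} (μ : D.CyclotomeMod l N) {Es : Set ℕ+}
  (τw : D.CyclotomeTower l Es) (c : CyclotomeCoefficients (phi C) (D.lDeltaTheta l) (PadicAlgCl p)ˣ)
  (hlev : ∀ (ζ : cyclotome (PadicAlgCl p)ˣ) (M : ℕ+),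
    (((τw.modAll M).red (c.hom ζ) : MuN p M) : (PadicAlgCl p)ˣ) = (ζ : ℕ+ → (PadicAlgCl p)ˣ) M)
  (α : (Pi C) ≃ₜ* (Pi C)) (τ : GQp p)

/-- `ᾱ := rangeAutOfCor218i α` carries `l·Δ_Θ` into `l·Δ_Θ`: the image of `c ζ` as an element of `l·Δ_Θ`.
[cite: MochizukiEtTh2009, Cor 2.18 (i) p.60] -/
theorem rangeAutOfCor218i_coe_mem_lDeltaTheta (hC : D.Compat) (hS : D.Sec2Hyps) (h15 : D.Prop15iii E hC)
    (L : C.CuspLabels) (R : RigidData.{0} N l) (hR : R = C.rigidData μ hC hS h15 L) (h218i : R.Cor218_i)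
    (z : D.lDeltaTheta l) :
    ((rangeAutOfCor218i C μ hq hC hS h15 L R hR h218i α
        ⟨(z : D.GtpTheta), lDeltaTheta_le_phiRange C z.2⟩ : phiRange C) : D.GtpTheta) ∈ D.lDeltaTheta l := by
  have hz : (⟨(z : D.GtpTheta), lDeltaTheta_le_phiRange C z.2⟩ : phiRange C) ∈
      (D.lDeltaTheta l).subgroupOf (phiRange C) := Subgroup.mem_subgroupOf.2 z.2
  exact Subgroup.mem_subgroupOf.1
    ((mem_lDeltaTheta_iff_rangeAutOfCor218i C μ hq hC hS h15 L R hR h218i α _).1 hz)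

include hlev in
/-- **The cyclotome compatibility «`c ∘ Λ(e_τ) = ᾱ ∘ c`» from (HCYC)**: if the level-`M` cyclotomic rigidity
identifications `red_M : l·Δ_Θ ↠ μ_M` are natural under `(α, τ)` for every `M`, then the change of coefficient
cyclotome `c` (pinned by `red_M (c ζ) = ζ_M`) intertwines `Λ(e_τ)` on `Λ(ℚ̄_pˣ) = Ẑ(1)` with `ᾱ` on `l·Δ_Θ` — both
sides have the same reductions `τ(ζ_M)` at every level, and the tower is jointly injective under the origin guard.
[cite: Mochizuki2012, Cor 1.11 p.49] -/
theorem coe_hom_map_unitsGalEquiv_eq_of_natural (hC : D.Compat) (hS : D.Sec2Hyps) (h15 : D.Prop15iii E hC)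
    (L : C.CuspLabels) (R : RigidData.{0} N l) (hR : R = C.rigidData μ hC hS h15 L) (h218i : R.Cor218_i)
    (hnat : ∀ (M : ℕ+) (z w : D.lDeltaTheta l),
      ((rangeAutOfCor218i C μ hq hC hS h15 L R hR h218i α
          ⟨(z : D.GtpTheta), lDeltaTheta_le_phiRange C z.2⟩ : phiRange C) : D.GtpTheta) = (w : D.GtpTheta) →
        (τw.modAll M).red w = galMuN p M τ ((τw.modAll M).red z))
    (hO' : D.IsEtThOrigin) (ζ : cyclotome (PadicAlgCl p)ˣ) :
    ((c.hom (cyclotome.map (Units.mapEquiv (τ : PadicAlgCl p ≃ₐ[ℚ_[p]] PadicAlgCl p).toMulEquiv).toMonoidHom ζ) :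
        D.lDeltaTheta l) : D.GtpTheta) =
      ((rangeAutOfCor218i C μ hq hC hS h15 L R hR h218i α
        ⟨(c.hom ζ : D.GtpTheta), lDeltaTheta_le_phiRange C (c.hom ζ).2⟩ : phiRange C) : D.GtpTheta) := by
  set w : D.lDeltaTheta l := ⟨_, rangeAutOfCor218i_coe_mem_lDeltaTheta C hq μ α hC hS h15 L R hR h218i (c.hom ζ)⟩
    with hw
  change _ = (w : D.GtpTheta)
  congr 1
  refine eq_of_forall_modAll_red_eq hO' τw fun M => ?_
  rw [hnat M (c.hom ζ) w rfl]
  apply Subtype.ext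
  apply Units.ext
  rw [hlev, galMuN_apply_coe, hlev]
  rfl

end Cyclotome

/-! ### 3. «hsemi» at `A = ℚ̄_pˣ` from (HGAL) ∧ (HCYC) -/

section Hsemi

variable (hq : IsQuotientMap D.toTheta) {N : ℕ+} (μ : D.CyclotomeMod l N) {Es : Set ℕ+}
  (τw : D.CyclotomeTower l Es) (c : CyclotomeCoefficients (phi C) (D.lDeltaTheta l) (PadicAlgCl p)ˣ)
  (hlev : ∀ (ζ : cyclotome (PadicAlgCl p)ˣ) (M : ℕ+),
    (((τw.modAll M).red (c.hom ζ) : MuN p M) : (PadicAlgCl p)ˣ) = (ζ : ℕ+ → (PadicAlgCl p)ˣ) M)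
  (O : Submonoid (PadicAlgCl p)ˣ)
  (hO : ∀ (σ : GQp p) (u : (PadicAlgCl p)ˣ), u ∈ O → Units.map (σ : PadicAlgCl p →* PadicAlgCl p) u ∈ O)

include hlev hO in
/-- **«hsemi» for the genuine constants from the two printed functorialities.**  Suppose that for every topological
automorphism `α` of `Π^tp_X̲̲` there is `τ ∈ G_{ℚ_p}` with (HGAL) `ε ∘ α = Inn(τ) ∘ ε` ([AbsTopIII] Cor. 1.10 at the
MLF `k̄ = ℚ̄_p`: the induced field automorphism is Galois) and (HCYC) `red_M ∘ ᾱ = τ ∘ red_M` on `l·Δ_Θ` for all `M`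
([IUTchII] Cor. 1.11 (b) / [EtTh] Cor. 2.19 (i): the cyclotomic rigidity isomorphism is functorial in `α`).  Then for
every `α` there is a semilinear automorphism `e` of `ℚ̄_pˣ` over `α`, compatible with the tower coefficients `c`
through `ᾱ = rangeAutOfCor218i α`, carrying the `G_{ℚ_p}`-stable constant monoid `O` onto itself — VERBATIM the
hypothesis `hsemi` of abc-iut-w5-d169's `exists_equivariant_h1LimKummerOn_of_semilinear` /
`map_mrange_h1LimKummerOn_eq_of_semilinear` at `A = ℚ̄_pˣ`, i.e. binder (P3) of [IUTchII] Prop. 3.4 (i) at the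
genuine constant-monoid Kummer map. [cite: Mochizuki2012, Prop 3.4 (i) p.91] -/
theorem hsemi_units_of_galois (hC : D.Compat) (hS : D.Sec2Hyps) (h15 : D.Prop15iii E hC)
    (L : C.CuspLabels) (R : RigidData.{0} N l) (hR : R = C.rigidData μ hC hS h15 L) (h218i : R.Cor218_i)
    (hO' : D.IsEtThOrigin)
    (hgal : ∀ α : (Pi C) ≃ₜ* (Pi C), ∃ τ : GQp p,
      (∀ x : Pi C, aug C (α x) = τ * aug C x * τ⁻¹) ∧
      (∀ (M : ℕ+) (z w : D.lDeltaTheta l),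
        ((rangeAutOfCor218i C μ hq hC hS h15 L R hR h218i α
            ⟨(z : D.GtpTheta), lDeltaTheta_le_phiRange C z.2⟩ : phiRange C) : D.GtpTheta) = (w : D.GtpTheta) →
          (τw.modAll M).red w = galMuN p M τ ((τw.modAll M).red z)))
    (α : (Pi C) ≃ₜ* (Pi C)) :
    ∃ e : (PadicAlgCl p)ˣ ≃* (PadicAlgCl p)ˣ,
      (∀ (x : Pi C) (a : (PadicAlgCl p)ˣ), x • e a = e (α.symm x • a)) ∧
      (∀ ζ : cyclotome (PadicAlgCl p)ˣ,
        ((c.hom (cyclotome.map e.toMonoidHom ζ) : D.lDeltaTheta l) : D.GtpTheta) =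
          ((rangeAutOfCor218i C μ hq hC hS h15 L R hR h218i α
            ⟨(c.hom ζ : D.GtpTheta), lDeltaTheta_le_phiRange C (c.hom ζ).2⟩ : phiRange C) : D.GtpTheta)) ∧
      (∀ a, a ∈ O ↔ e a ∈ O) := by
  obtain ⟨τ, hτ, hnat⟩ := hgal α
  exact ⟨Units.mapEquiv (τ : PadicAlgCl p ≃ₐ[ℚ_[p]] PadicAlgCl p).toMulEquiv,
    unitsGalEquiv_semilinear C α τ hτ,
    coe_hom_map_unitsGalEquiv_eq_of_natural C hq μ τw c hlev α τ hC hS h15 L R hR h218i hnat hO',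
    mem_iff_unitsGalEquiv_mem τ O hO⟩

end Hsemi

/-! ### 4. Non-vacuity / consistency: (HGAL) ∧ (HCYC) hold for every INNER automorphism -/

section Inner

variable (hq : IsQuotientMap D.toTheta) {N : ℕ+} (μ : D.CyclotomeMod l N) {Es : Set ℕ+}
  (τw : D.CyclotomeTower l Es)

/-- (HGAL) for `conj g`: `ε(g x g⁻¹) = ε g · ε x · (ε g)⁻¹`. [cite: MochizukiAbsTopIII2015, Cor 1.10 p.46] -/
theorem aug_conjCME (g x : Pi C) : aug C (conjCME g x) = aug C g * aug C x * (aug C g)⁻¹ := by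
  rw [conjCME_apply, map_mul, map_mul, map_inv]

/-- (HCYC) for `conj g`: `red_M (φ(g) z φ(g)⁻¹) = ε(g) (red_M z)` — the tower's own `red_conj`, since the automorphism
of `φ(Π^tp_X̲̲)` induced by `conj g` is `conj φ(g)` (abc-iut-w5-d169's `rangeAut_apply_of_inner`).
[cite: MochizukiEtTh2009, Def 2.13 p.46] -/
theorem modAll_red_eq_of_inner (hC : D.Compat) (hS : D.Sec2Hyps) (h15 : D.Prop15iii E hC)
    (L : C.CuspLabels) (R : RigidData.{0} N l) (hR : R = C.rigidData μ hC hS h15 L) (h218i : R.Cor218_i)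
    (g : Pi C) (M : ℕ+) (z w : D.lDeltaTheta l)
    (hzw : ((rangeAutOfCor218i C μ hq hC hS h15 L R hR h218i (conjCME g)
        ⟨(z : D.GtpTheta), lDeltaTheta_le_phiRange C z.2⟩ : phiRange C) : D.GtpTheta) = (w : D.GtpTheta)) :
    (τw.modAll M).red w = galMuN p M (aug C g) ((τw.modAll M).red z) := by
  have hw : w = MulAut.conjNormal (phi C g) z := by
    apply Subtype.ext
    rw [← hzw, rangeAutOfCor218i,
      rangeAut_apply_of_inner C hq (conjCME g) _ g (fun x => conjCME_apply g x)]
    rw [MulAut.conjNormal_apply]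
    rfl
  rw [hw]
  apply Subtype.ext
  apply Units.ext
  rw [coe_modAll_red_conjNormal, galMuN_apply_coe, units_coe_smul]

/-- **(HGAL) ∧ (HCYC) for every inner automorphism `conj g` of `Π^tp_X̲̲`, with `τ = ε g`**: the hypothesis `hgal`
of `hsemi_units_of_galois` restricted to `Inn(Π^tp_X̲̲)` is a THEOREM — the residual input of binder (P3) concerns
outer automorphisms only. [cite: Mochizuki2012, Prop 3.1 (ii) p.88] -/
theorem hgal_of_inner (hC : D.Compat) (hS : D.Sec2Hyps) (h15 : D.Prop15iii E hC)
    (L : C.CuspLabels) (R : RigidData.{0} N l) (hR : R = C.rigidData μ hC hS h15 L) (h218i : R.Cor218_i)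
    (g : Pi C) :
    ∃ τ : GQp p,
      (∀ x : Pi C, aug C (conjCME g x) = τ * aug C x * τ⁻¹) ∧
      (∀ (M : ℕ+) (z w : D.lDeltaTheta l),
        ((rangeAutOfCor218i C μ hq hC hS h15 L R hR h218i (conjCME g)
            ⟨(z : D.GtpTheta), lDeltaTheta_le_phiRange C z.2⟩ : phiRange C) : D.GtpTheta) = (w : D.GtpTheta) →
          (τw.modAll M).red w = galMuN p M τ ((τw.modAll M).red z)) :=
  ⟨aug C g, aug_conjCME C g, modAll_red_eq_of_inner C hq μ τw hC hS h15 L R hR h218i g⟩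

end Inner

end EtaleThetaDataOfSetting

end Literature.IUT.HodgeArakelov

end
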